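import Mathlib
import Summits.NavierStokesRegularity.NavierStokesRegularity.Theorems.DssFarFieldSlavingBlowupTypeIDssProfileSimilarityEnstrophyCrossFlowNoDecay
import HarnessLib

/-!
# The HESSIAN COLLAR for the cut-off similarity enstrophy: `‖D²φ_R‖ ≤ c_H/R²` and the weighted
  div–curl bound `∫φ_R‖curl Ω‖² ≤ ∫φ_R|∇Ω|²_F + (c_H/R²)∫_{B̄_{2R}}‖Ω‖²` for every KNSS-gauge Type-I
  ancient mild field (pub-ns-dss, route `DssFarFieldSlaving`, crux `BlowupTypeIDssProfile`,
  stmt-NavierStokesRegularity-0155 — SUPPORT; typer seat g20, 2026-08-26; LABEL-FREE vector-calculus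
  kit for `…SimilarityEnstrophyCrossFlowNoDecayOne`, which removes the factor `2` of the pointwise
  bound `‖curl Ω‖² ≤ 2|∇Ω|²_F` used in `…SimilarityEnstrophyCrossFlowNoDecay`)

HONEST FRAMING. Estimates about a HYPOTHETICAL object (a Type-I ancient mild solution in the KNSS gauge,
`IsTypeIAncientMild C V`, ANY `C`, no spatial hypothesis); no threshold, no census word, nothing numerical;
nothing here bears on Navier–Stokes regularity or blow-up.

CONTENTS. `exists_norm_iteratedFDeriv_two_smoothTransition_cutoff_le` (‖D²φ_R(y)‖ ≤ c/R² by scaling of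
the unit cut-off, `norm_iteratedFDeriv_comp_smul_le`; companion of the tree's gradient / Laplacian bounds
`exists_norm_fderiv_smoothTransition_cutoff_le`, `exists_abs_laplacian_smoothTransition_cutoff_le`);
`integral_cutoff_mul_norm_curl_sq_le` (the tree's weighted div–curl identity
`integral_mul_frobeniusNormSq_fderiv_eq`, `∫φ|∇Ω|²_F = ∫φ‖curl Ω‖² − ∫Dφ((Ω·∇)Ω)` for divergence-free `Ω`,
with the error term rewritten as the Hessian collar `−∫D²φ(Ω, Ω)` by one more integration by parts —
`∫⟪Ω, ∇[Dφ(Ω)]⟫ = −∫Dφ(Ω)·div Ω = 0`, `integral_mul_divergence_add_eq_zero_left` — and bounded by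
`(c_H/R²)∫_{B̄_{2R}}‖Ω‖²`).
-/

noncomputable section

set_option linter.dupNamespace false

namespace Summit.NavierStokesRegularity.NavierStokesRegularity.Theorems.SimilarityEnstrophy

open MeasureTheory Set Filter Topology Metric InnerProductSpace Function Real
open scoped RealInnerProductSpace Laplacian ContDiff
open Literature.Analysis Literature.Analysis.FluidPDE
open Summit.NavierStokesRegularity.NavierStokesRegularity.Theorems
open Summit.NavierStokesRegularity.NavierStokesRegularity.Theorems.GaussianGap
open Summit.NavierStokesRegularity.NavierStokesRegularity.Theorems.BlobRiccatiClosure.TypeIApexLiouville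

variable {C : ℝ} {V : ℝ → EuclideanSpace ℝ (Fin 3) → EuclideanSpace ℝ (Fin 3)}

/-! ### The Hessian of the cut-off: `‖D²φ_R‖ ≤ c_H/R²` -/

/-- **Hessian bound for the cut-off `φ_R(y) = smoothTransition (2 − ‖y‖²/R²)`**: there is `c` independent
of `R` with `‖D²φ_R(y)‖ ≤ c/R²` for all `R > 0`, `y` (scaling of the unit cut-off, whose second derivative is
continuous with compact support; companion of the tree's gradient and Laplacian bounds
`exists_norm_fderiv_smoothTransition_cutoff_le`, `exists_abs_laplacian_smoothTransition_cutoff_le`). [folklore] -/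
theorem exists_norm_iteratedFDeriv_two_smoothTransition_cutoff_le :
    ∃ c : ℝ, 0 ≤ c ∧ ∀ R : ℝ, 0 < R → ∀ y : EuclideanSpace ℝ (Fin 3),
      ‖iteratedFDeriv ℝ 2 (fun z : EuclideanSpace ℝ (Fin 3) => smoothTransition (2 - ‖z‖ ^ 2 / R ^ 2)) y‖
        ≤ c / R ^ 2 := by
  have h2 : ContDiff ℝ 2 fun z : EuclideanSpace ℝ (Fin 3) => smoothTransition (2 - ‖z‖ ^ 2) :=
    contDiff_smoothTransition_unitCutoff (n := 2)
  have h1 : HasCompactSupport fun z : EuclideanSpace ℝ (Fin 3) => smoothTransition (2 - ‖z‖ ^ 2) := by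
    have := hasCompactSupport_smoothTransition_cutoff (E := EuclideanSpace ℝ (Fin 3)) one_pos
    simpa using this
  have hcont : Continuous fun x => iteratedFDeriv ℝ 2
      (fun z : EuclideanSpace ℝ (Fin 3) => smoothTransition (2 - ‖z‖ ^ 2)) x :=
    h2.continuous_iteratedFDeriv le_rfl
  have hsupp : HasCompactSupport (iteratedFDeriv ℝ 2
      fun z : EuclideanSpace ℝ (Fin 3) => smoothTransition (2 - ‖z‖ ^ 2)) := h1.iteratedFDeriv 2
  obtain ⟨c, hc⟩ := hcont.bounded_above_of_compact_support hsupp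
  refine ⟨max c 0, le_max_right _ _, fun R hR y => ?_⟩
  rw [smoothTransition_cutoff_eq_comp_smul hR]
  refine (norm_iteratedFDeriv_comp_smul_le
    (fun z : EuclideanSpace ℝ (Fin 3) => smoothTransition (2 - ‖z‖ ^ 2)) (inv_ne_zero hR.ne') 2 y).trans ?_
  rw [abs_of_pos (inv_pos.2 hR), inv_pow, ← one_div, div_mul_eq_mul_div, one_mul]
  exact div_le_div_of_nonneg_right ((hc _).trans (le_max_left _ _)) (by positivity)

/-! ### The weighted div–curl bound with a Hessian collar -/

/-- **Weighted `curl`–Frobenius comparison with a Hessian collar** (one slice): for a KNSS-gauge Type-I field,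
`∫ φ_R ‖curl Ω‖² ≤ ∫ φ_R |∇Ω|²_F + (c_H/R²) ∫_{B̄_{2R}} ‖Ω‖²` — the tree's weighted div–curl identity
`∫φ|∇Ω|²_F = ∫φ‖curl Ω‖² − ∫Dφ((Ω·∇)Ω)` (`integral_mul_frobeniusNormSq_fderiv_eq`, `div Ω = 0`), the error
rewritten as `−∫D²φ(Ω, Ω)` by one more integration by parts (`∫ D[Dφ(Ω)](Ω) = −∫ Dφ(Ω)·div Ω = 0`,
`integral_mul_divergence_add_eq_zero_left`), and the Hessian collar bound. [this file; folklore] -/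
theorem integral_cutoff_mul_norm_curl_sq_le (hV : IsTypeIAncientMild C V) {c_H : ℝ}
    (hcH : ∀ R : ℝ, 0 < R → ∀ y : EuclideanSpace ℝ (Fin 3),
      ‖iteratedFDeriv ℝ 2 (fun z : EuclideanSpace ℝ (Fin 3) => smoothTransition (2 - ‖z‖ ^ 2 / R ^ 2)) y‖
        ≤ c_H / R ^ 2)
    {R : ℝ} (hR : 0 < R) (s : ℝ) :
    (∫ y, smoothTransition (2 - ‖y‖ ^ 2 / R ^ 2) * ‖curl (lerayVorticity V s) y‖ ^ 2) ≤
      (∫ y, smoothTransition (2 - ‖y‖ ^ 2 / R ^ 2) * frobeniusNormSq (fderiv ℝ (lerayVorticity V s) y)) +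
        c_H / R ^ 2 * ∫ y in closedBall (0 : EuclideanSpace ℝ (Fin 3)) (2 * R), ‖lerayVorticity V s y‖ ^ 2 := by
  set φ : EuclideanSpace ℝ (Fin 3) → ℝ := fun z => smoothTransition (2 - ‖z‖ ^ 2 / R ^ 2)
    with hφdef
  set Ω := lerayVorticity V s with hΩdef
  have hφ1 : ContDiff ℝ 1 φ := contDiff_smoothTransition_cutoff (n := 1) R
  have hφ2 : ContDiff ℝ 2 φ := contDiff_smoothTransition_cutoff (n := 2) R
  have hφc : HasCompactSupport φ := hasCompactSupport_smoothTransition_cutoff hR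
  have hΩ1 : ContDiff ℝ 1 Ω := signedBudget_contDiff_lerayVorticity_slice hV s (n := 1)
  have hΩ2 : ContDiff ℝ 2 Ω := signedBudget_contDiff_lerayVorticity_slice hV s (n := 2)
  have hdivΩ : VectorCalculus.IsDivFree Ω := fun y =>
    divergence_curl_eq_zero_holds _
      ((contDiff_lerayOrbit_slice_of_typeI hV s (n := (⊤ : ℕ∞)) le_rfl).of_le (by norm_cast)) y
  have hcΩ : Continuous Ω := hΩ1.continuous
  have hcDΩ : Continuous (fderiv ℝ Ω) := hΩ1.continuous_fderiv one_ne_zero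
  have hDφ1 : ContDiff ℝ 1 (fderiv ℝ φ) := hφ2.fderiv_right (m := 1) (by norm_num)
  have hcDφ : Continuous (fderiv ℝ φ) := hDφ1.continuous
  have hcH2 : Continuous fun x => iteratedFDeriv ℝ 2 φ x := hφ2.continuous_iteratedFDeriv le_rfl
  -- the Hessian of the cut-off vanishes off `B̄_{2R}` (it is supported in `tsupport φ ⊆ B̄_{2R}`)
  have htsupp : tsupport φ ⊆ closedBall (0 : EuclideanSpace ℝ (Fin 3)) (2 * R) := by
    have hsub : support φ ⊆ ball (0 : EuclideanSpace ℝ (Fin 3)) (2 * R) := by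
      intro y hy
      rw [mem_ball_zero_iff]
      by_contra hge
      exact hy (by rw [hφdef]; exact smoothTransition_cutoff_eq_zero hR (not_lt.1 hge))
    calc tsupport φ = closure (support φ) := rfl
      _ ⊆ closure (ball (0 : EuclideanSpace ℝ (Fin 3)) (2 * R)) := closure_mono hsub
      _ = closedBall (0 : EuclideanSpace ℝ (Fin 3)) (2 * R) := closure_ball 0 (by positivity)
  have hHsupp : ∀ y ∉ closedBall (0 : EuclideanSpace ℝ (Fin 3)) (2 * R), iteratedFDeriv ℝ 2 φ y = 0 := by
    intro y hy
    have hy' : y ∉ support (iteratedFDeriv ℝ 2 φ) := fun h =>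
      hy (htsupp (support_iteratedFDeriv_subset 2 h))
    simpa [mem_support] using hy'
  -- the weighted div–curl identity
  have hid := integral_mul_frobeniusNormSq_fderiv_eq hΩ2 hdivΩ hφ1 hφc
  -- the second integration by parts: `∫ D[Dφ(Ω)](Ω) = 0`
  set Ψ : EuclideanSpace ℝ (Fin 3) → ℝ := fun x => fderiv ℝ φ x (Ω x) with hΨdef
  have hΨ1 : ContDiff ℝ 1 Ψ := hDφ1.clm_apply hΩ1
  have hΨc : HasCompactSupport Ψ :=
    (hφc.fderiv (𝕜 := ℝ)).mono fun x hx => by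
      contrapose! hx
      simp only [mem_support, not_not] at hx ⊢
      simp [hΨdef, hx]
  have hkey := integral_mul_divergence_add_eq_zero_left hΨ1 hΩ1 hΨc
  simp_rw [hdivΩ _, mul_zero, integral_zero, zero_add] at hkey
  -- `⟪Ω, ∇Ψ⟫ = DΨ(Ω) = D²φ(Ω, Ω) + Dφ(DΩ(Ω))`
  have hpt : ∀ x, ⟪Ω x, gradient Ψ x⟫ =
      iteratedFDeriv ℝ 2 φ x ![Ω x, Ω x] + fderiv ℝ φ x (fderiv ℝ Ω x (Ω x)) := by
    intro x
    rw [real_inner_comm, gradient, InnerProductSpace.toDual_symm_apply, hΨdef,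
      fderiv_clm_apply ((hDφ1.differentiable one_ne_zero) x) ((hΩ1.differentiable one_ne_zero) x),
      iteratedFDeriv_two_apply]
    simp only [_root_.add_apply, ContinuousLinearMap.comp_apply,
      ContinuousLinearMap.flip_apply, Matrix.cons_val_zero, Matrix.cons_val_one]
    ring
  -- integrability
  have iG : Integrable fun x => ⟪Ω x, gradient Ψ x⟫ := by
    refine (hcΩ.inner (continuous_gradient_of_contDiff hΨ1)).integrable_of_hasCompactSupport ?_
    exact (hΨc.fderiv (𝕜 := ℝ)).mono fun x hx => by
      contrapose! hx
      simp only [mem_support, not_not] at hx ⊢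
      simp [gradient, hx]
  have iE : Integrable fun x => fderiv ℝ φ x (fderiv ℝ Ω x (Ω x)) := by
    refine (hcDφ.clm_apply (hcDΩ.clm_apply hcΩ)).integrable_of_hasCompactSupport ?_
    exact (hφc.fderiv (𝕜 := ℝ)).mono fun x hx => by
      contrapose! hx
      simp only [mem_support, not_not] at hx ⊢
      simp [hx]
  have hE : (∫ x, fderiv ℝ φ x (fderiv ℝ Ω x (Ω x))) = -∫ x, iteratedFDeriv ℝ 2 φ x ![Ω x, Ω x] := by
    have h1 : (∫ x, iteratedFDeriv ℝ 2 φ x ![Ω x, Ω x]) =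
        (∫ x, ⟪Ω x, gradient Ψ x⟫) - ∫ x, fderiv ℝ φ x (fderiv ℝ Ω x (Ω x)) := by
      rw [← integral_sub iG iE]
      exact integral_congr_ae (Eventually.of_forall fun x => by simp only [hpt x]; ring)
    rw [h1, hkey]
    ring
  -- the Hessian collar
  have hcollar : |∫ x, iteratedFDeriv ℝ 2 φ x ![Ω x, Ω x]| ≤
      c_H / R ^ 2 * ∫ y in closedBall (0 : EuclideanSpace ℝ (Fin 3)) (2 * R), ‖Ω y‖ ^ 2 := by
    have hcw : Continuous fun y => ‖iteratedFDeriv ℝ 2 φ y‖ := hcH2.norm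
    refine abs_integral_le_of_weight_sq hcΩ (w := fun y => ‖iteratedFDeriv ℝ 2 φ y‖) hcw
      (fun y hy => ?_) (fun y _ => hcH R hR y) (fun y => ?_)
    · show ‖iteratedFDeriv ℝ 2 φ y‖ = 0
      rw [hHsupp y hy, norm_zero]
    · rw [← Real.norm_eq_abs]
      calc ‖iteratedFDeriv ℝ 2 φ y ![Ω y, Ω y]‖
          ≤ ‖iteratedFDeriv ℝ 2 φ y‖ * ∏ i, ‖(![Ω y, Ω y] : Fin 2 → EuclideanSpace ℝ (Fin 3)) i‖ :=
            ContinuousMultilinearMap.le_opNorm _ _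
        _ = ‖iteratedFDeriv ℝ 2 φ y‖ * ‖Ω y‖ ^ 2 := by
            rw [Fin.prod_univ_two]
            simp only [Matrix.cons_val_zero, Matrix.cons_val_one]
            ring
  rw [hid, hE]
  linarith [(neg_le_abs _).trans hcollar, (le_abs_self _).trans hcollar]

end Summit.NavierStokesRegularity.NavierStokesRegularity.Theorems.SimilarityEnstrophy

end
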